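/-
VALUE = THEOREM, NOT summit progress (cell b2b-lgcu-borel, gen 25); crux 14079 untouched.
-/
import Mathlib
import Summits.MatrixMultiplication.MatrixMultiplication.Theorems.SubgroupIdentityDesigns.Negative.OppositeRootPairs
import Summits.MatrixMultiplication.MatrixMultiplication.Theorems.SubgroupIdentityDesigns.Negative.UnitriangularSylow
import Summits.MatrixMultiplication.MatrixMultiplication.Theorems.SubgroupIdentityDesigns.Negative.BorelConfinement

/-!
# The `p`-local trichotomy for the members of a level-one witness in `GL₃(𝔽_p)`

VALUE = THEOREM (structure law on HYPOTHETICAL level-one witnesses of the crux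
`SubgroupIdentityDesigns`, `m = 3`, `k = 1`), NOT summit progress.  The crux item is neither
restated nor weakened; this file is a `--supports` helper under `Negative/`, the quotable capstone
of the generation-25 chain `FixedPointLaw → NormalSylowLaw → UnitriangularSylow → RootElements →
TransvectionSylow → OppositeRootPairs`.

`quadratic_unipotent_member_sylow_normal`: in a subgroup-TPP triple of `GL₃(𝔽_p)` (`p ≥ 3`) with
a level-one identity design and the crux inequality (`−2 < ε ≤ 1`), a member containing some
`u ≠ 1` with `(u − 1)² = 0` has all its Sylow `p`-subgroups normal
(`OppositeRootPairs.transvection_member_sylow_normal`).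

`member_trichotomy` (THE `p`-LOCAL TRICHOTOMY).  Under the same hypotheses every member `H`
satisfies: every Sylow `p`-subgroup has order `≤ p²` (`UnitriangularSylow`), AND either
  (N) every Sylow `p`-subgroup of `H` is normal (then `H` is `p'` or reducible with
      `H ≤ N(P)`, `NormalSylowLaw`), or
  (S) every Sylow `p`-subgroup of `H` has order `≤ p` and `H` contains NO quadratic unipotent:
      `u ∈ H`, `(u − 1)² = 0 ⇒ u = 1` (its `p`-elements are regular unipotents).

`member_classification` (THE FOUR CLASSES).  Same hypotheses; with `BorelConfinement` and the
Sylow orders `1, p, p²` the trichotomy becomes: every member `H` is of exactly one of the types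
  (Z)  `p ∤ |H|`;
  (N₁) Sylow `p`-subgroup normal of order `p` AND `H` fixes a full flag `⟨v⟩ ⊂ ker ψ` (Borel);
  (N₂) Sylow `p`-subgroup normal of order `p²`;
  (S)  `p + 1` or more Sylow `p`-subgroups, each of order `p`, and no quadratic unipotent in `H`.

HONEST SCOPE.  Structure law; it empties no `(p, m, ε)` cell.  Sorry-free; standard axioms.
-/

set_option linter.dupNamespace false

noncomputable section

open scoped BigOperators Classical Matrix

namespace Summit.MatrixMultiplication.MatrixMultiplication.Theorems.SubgroupIdentityDesigns.Negative
namespace MemberTrichotomy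

open Summit.MatrixMultiplication.MatrixMultiplication.Theorems.LieRankDesigns.Negative (GLm Mat budget)
open Literature.Barriers.MatrixMultiplication (SubgroupTPP)
open Matrix (vecMulVec)

variable {p : ℕ} [hp : Fact p.Prime]

/-! ## The trichotomy -/

section Main

variable {H₁ H₂ H₃ : Subgroup (GLm p 3)}

/-- **QUADRATIC UNIPOTENT ⇒ NORMAL SYLOW.**  A member containing `u ≠ 1` with `(u − 1)² = 0` has
all its Sylow `p`-subgroups normal. -/
theorem quadratic_unipotent_member_sylow_normal (hp3 : 3 ≤ p) {ε : ℝ} (hε : -2 < ε) (hε1 : ε ≤ 1)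
    (htpp : SubgroupTPP H₁ H₂ H₃)
    (hdes : ∃ cf : Mat p 3 → ℂ, (∀ M, 1 < M.rank → cf M = 0) ∧
      (∑ M, cf M * ZMod.stdAddChar (Matrix.trace (M * ((1 : GLm p 3) : Mat p 3)))) = 1 ∧
      ∀ a ∈ H₁, ∀ b ∈ H₂, ∀ g ∈ H₃, a * b * g ≠ 1 →
        (∑ M, cf M * ZMod.stdAddChar (Matrix.trace (M * ((a * b * g : GLm p 3) : Mat p 3)))) = 0)
    (hlt : budget p 3 1 (2 + ε) < ((Nat.card H₁ * Nat.card H₂ * Nat.card H₃ : ℕ) : ℝ) ^ ((2 + ε) / 3))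
    (H : Subgroup (GLm p 3)) (hH : H = H₁ ∨ H = H₂ ∨ H = H₃)
    {u : GLm p 3} (huH : u ∈ H) (hu1 : u ≠ 1)
    (hsq : ((u : Mat p 3) - 1) * ((u : Mat p 3) - 1) = 0) :
    ∀ P : Sylow p H, (P : Subgroup H).Normal := by
  have hN : (u : Mat p 3) - 1 ≠ 0 := by
    intro h0
    exact hu1 (Units.ext (by rw [Units.val_one]; exact sub_eq_zero.mp h0))
  obtain ⟨c, φ, hc, hφ, hφc, hcφ⟩ := BorelConfinement.exists_vecMulVec_of_sq_zero hN hsq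
  have hu : (u : Mat p 3) = 1 + vecMulVec c φ := by rw [← hcφ, add_sub_cancel]
  exact OppositeRootPairs.transvection_member_sylow_normal hp3 hε hε1 htpp hdes hlt H hH huH hu hc
    hφ hφc

/-- **THE `p`-LOCAL TRICHOTOMY** for the members of a hypothetical level-one witness in
`GL₃(𝔽_p)` (`p ≥ 3`, `−2 < ε ≤ 1`): Sylow orders `≤ p²`, and either all Sylow `p`-subgroups are
normal, or they all have order `≤ p` and the member contains no quadratic unipotent. -/
theorem member_trichotomy (hp3 : 3 ≤ p) {ε : ℝ} (hε : -2 < ε) (hε1 : ε ≤ 1)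
    (htpp : SubgroupTPP H₁ H₂ H₃)
    (hdes : ∃ cf : Mat p 3 → ℂ, (∀ M, 1 < M.rank → cf M = 0) ∧
      (∑ M, cf M * ZMod.stdAddChar (Matrix.trace (M * ((1 : GLm p 3) : Mat p 3)))) = 1 ∧
      ∀ a ∈ H₁, ∀ b ∈ H₂, ∀ g ∈ H₃, a * b * g ≠ 1 →
        (∑ M, cf M * ZMod.stdAddChar (Matrix.trace (M * ((a * b * g : GLm p 3) : Mat p 3)))) = 0)
    (hlt : budget p 3 1 (2 + ε) < ((Nat.card H₁ * Nat.card H₂ * Nat.card H₃ : ℕ) : ℝ) ^ ((2 + ε) / 3))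
    (H : Subgroup (GLm p 3)) (hH : H = H₁ ∨ H = H₂ ∨ H = H₃) :
    (∀ P : Sylow p H, Nat.card P ≤ p ^ 2) ∧
      ((∀ P : Sylow p H, (P : Subgroup H).Normal) ∨
        ((∀ P : Sylow p H, Nat.card P ≤ p) ∧
          ∀ u ∈ H, ((u : Mat p 3) - 1) * ((u : Mat p 3) - 1) = 0 → u = 1)) := by
  obtain ⟨s1, s2, s3⟩ := UnitriangularSylow.card_sylow_le_sq (H₁ := H₁) (H₂ := H₂) (H₃ := H₃) hdes
  obtain ⟨n1, n2, n3⟩ := NormalSylowLaw.crux_sylow_three hp3 hε hε1 htpp hdes hlt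
  have hsq : ∀ P : Sylow p H, Nat.card P ≤ p ^ 2 := by
    rcases hH with rfl | rfl | rfl
    exacts [s1, s2, s3]
  have hsmall : ∀ P : Sylow p H, (P : Subgroup H).Normal ∨ Nat.card P ≤ p := by
    rcases hH with rfl | rfl | rfl
    exacts [n1, n2, n3]
  refine ⟨hsq, ?_⟩
  by_cases hN : ∀ P : Sylow p H, (P : Subgroup H).Normal
  · exact Or.inl hN
  · right
    push Not at hN
    obtain ⟨P₀, hP₀⟩ := hN
    refine ⟨fun P => ?_, fun u huH hsq' => ?_⟩
    · rcases hsmall P with hPn | hP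
      · exfalso
        haveI := Sylow.unique_of_normal P hPn
        have hPP : P₀ = P := Subsingleton.elim _ _
        rw [hPP] at hP₀
        exact hP₀ hPn
      · exact hP
    · by_contra hu1
      exact hP₀ (quadratic_unipotent_member_sylow_normal hp3 hε hε1 htpp hdes hlt H hH huH hu1
        hsq' P₀)

/-- Sylow orders of a member are `1`, `p` or `p²`. -/
theorem card_sylow_cases {H : Subgroup (GLm p 3)} (hsq : ∀ P : Sylow p H, Nat.card P ≤ p ^ 2)
    (P : Sylow p H) : Nat.card P = 1 ∨ Nat.card P = p ∨ Nat.card P = p ^ 2 := by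
  have h := P.card_eq_multiplicity
  obtain ⟨k, hk⟩ : ∃ k, (Nat.card H).factorization p = k := ⟨_, rfl⟩
  rw [hk] at h
  rcases Nat.lt_or_ge k 3 with hlt | hge
  · interval_cases k
    · exact Or.inl (by rw [h, pow_zero])
    · exact Or.inr (Or.inl (by rw [h, pow_one]))
    · exact Or.inr (Or.inr h)
  · exfalso
    have h1 := hsq P
    rw [h] at h1
    have h2 : p ^ 2 < p ^ k := Nat.pow_lt_pow_right hp.out.one_lt (by omega)
    omega

/-- **THE FOUR CLASSES** of members of a hypothetical level-one witness in `GL₃(𝔽_p)` (`p ≥ 3`,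
`−2 < ε ≤ 1`): (Z) `p'`-group; (N₁) normal Sylow of order `p` and `H` fixes a full flag (Borel);
(N₂) normal Sylow of order `p²`; (S) non-normal Sylow subgroups of order `p` and no quadratic
unipotent. -/
theorem member_classification (hp3 : 3 ≤ p) {ε : ℝ} (hε : -2 < ε) (hε1 : ε ≤ 1)
    (htpp : SubgroupTPP H₁ H₂ H₃)
    (hdes : ∃ cf : Mat p 3 → ℂ, (∀ M, 1 < M.rank → cf M = 0) ∧
      (∑ M, cf M * ZMod.stdAddChar (Matrix.trace (M * ((1 : GLm p 3) : Mat p 3)))) = 1 ∧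
      ∀ a ∈ H₁, ∀ b ∈ H₂, ∀ g ∈ H₃, a * b * g ≠ 1 →
        (∑ M, cf M * ZMod.stdAddChar (Matrix.trace (M * ((a * b * g : GLm p 3) : Mat p 3)))) = 0)
    (hlt : budget p 3 1 (2 + ε) < ((Nat.card H₁ * Nat.card H₂ * Nat.card H₃ : ℕ) : ℝ) ^ ((2 + ε) / 3))
    (H : Subgroup (GLm p 3)) (hH : H = H₁ ∨ H = H₂ ∨ H = H₃) :
    (∀ P : Sylow p H, Nat.card P = 1) ∨
      ((∀ P : Sylow p H, (P : Subgroup H).Normal ∧ Nat.card P = p) ∧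
        ∃ v ψ : Fin 3 → ZMod p, v ≠ 0 ∧ ψ ≠ 0 ∧ ψ ⬝ᵥ v = 0 ∧
          ∀ h ∈ H, (∃ a : ZMod p, (h : Mat p 3) *ᵥ v = a • v) ∧
            (∃ b : ZMod p, ψ ᵥ* (h : Mat p 3) = b • ψ)) ∨
      (∀ P : Sylow p H, (P : Subgroup H).Normal ∧ Nat.card P = p ^ 2) ∨
      ((∀ P : Sylow p H, ¬ (P : Subgroup H).Normal ∧ Nat.card P = p) ∧
        ∀ u ∈ H, ((u : Mat p 3) - 1) * ((u : Mat p 3) - 1) = 0 → u = 1) := by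
  obtain ⟨hsq, htri⟩ := member_trichotomy hp3 hε hε1 htpp hdes hlt H hH
  obtain ⟨P₀⟩ := (inferInstance : Nonempty (Sylow p H))
  have hsame : ∀ P : Sylow p H, Nat.card P = Nat.card P₀ := fun P => by
    rw [P.card_eq_multiplicity, P₀.card_eq_multiplicity]
  have hp1 : 1 < p := hp.out.one_lt
  -- if some Sylow subgroup is normal, all are (there is only one)
  have hall : ∀ P : Sylow p H, (P : Subgroup H).Normal → ∀ Q : Sylow p H, (Q : Subgroup H).Normal := by
    intro P hPn Q
    haveI := Sylow.unique_of_normal P hPn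
    rw [Subsingleton.elim Q P]
    exact hPn
  rcases card_sylow_cases hsq P₀ with h1 | hP | hP2
  · exact Or.inl fun P => (hsame P).trans h1
  · rcases htri with hN | ⟨-, hno⟩
    · refine Or.inr (Or.inl ⟨fun P => ⟨hN P, (hsame P).trans hP⟩, ?_⟩)
      exact BorelConfinement.exists_fixed_flag_of_normal H P₀ (hN P₀) hP
    · by_cases hex : ∃ P : Sylow p H, (P : Subgroup H).Normal
      · obtain ⟨P, hPn⟩ := hex
        refine Or.inr (Or.inl ⟨fun Q => ⟨hall P hPn Q, (hsame Q).trans hP⟩, ?_⟩)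
        exact BorelConfinement.exists_fixed_flag_of_normal H P₀ (hall P hPn P₀) hP
      · push Not at hex
        exact Or.inr (Or.inr (Or.inr ⟨fun P => ⟨hex P, (hsame P).trans hP⟩, hno⟩))
  · rcases htri with hN | ⟨hle, -⟩
    · exact Or.inr (Or.inr (Or.inl fun P => ⟨hN P, (hsame P).trans hP2⟩))
    · exfalso
      have h := hle P₀
      rw [hP2] at h
      have : p < p ^ 2 := by nlinarith
      omega

end Main

end MemberTrichotomy
end Summit.MatrixMultiplication.MatrixMultiplication.Theorems.SubgroupIdentityDesigns.Negative
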